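/-
Copyright: the b2b-balaban T⁴-continuum CRUX team, row NE7b OWNER lineage `t4-ne7b-p1` (gen 123). Project licence.
-/
import Summits.QuantumFields.BalabanUV.T4Continuum.Spine.NE7b.SupTorusPointwiseRoadColumn

/-!
# A SOURCE FAR FROM A CENTRE IS INVISIBLE NEAR IT: on the road's class `−λ ≤ V ≤ Λ`, `d ≥ 3`, if `Hw = g` with `|g| ≤ M` and `g = 0` on
# every block within `ρ_s`-distance `R` of a centre `y_c`, then `|w x| ≤ C·M·e^{δρ_s(bt x, y_c)}·e^{−δR}` at EVERY site, `(C, δ)` from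
# `(d, a, λ, Λ)` and `C(d)` only, every mesh, every volume — the block decomposition `g = Σ_yb 𝟙_{B_yb}g`, (155)'s pointwise propagator
# decay for each piece, linearity ∕ uniqueness ((133)) and the coarse exponential sum ((132)); the Cauchy estimate of the sequel's
# THERMODYNAMIC LIMIT along the tower of tori (row NE7b, node U5c; (132)∕(133)∕(148)∕(155) BY NAME; [folklore])

Cell `pub-balaban`, sub-cell `t4`, spine estimate NE7b (`T4WeightBudget.RelWeightBound`; the cell's OWN estimate — NOT PRINTED in
[Bałaban 1983–89], NOT PROVED).  Crux-route work under `Spine/NE7b/` by the row OWNER (`t4-ne7b-p1` gen 123, file (178)) under FREEZE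
(0)'s crux-prover clause; NOTHING of Bałaban's is named as a Lean object, valued or asserted; no `T4Continuum/Support` leaf typed; no `def`,
no notation (the action DISPLAYED exactly as in (133)–(161)); zero `sorry`.  Imports (BY NAME): the OWNER's (155)
`…SupTorusPointwiseRoadColumn` (`propagator_pointwise_decay_road`; through it (148) `action_surjective`, (133) `action_injective`,
`action_sum_smul`, (132) `isPseudoDist_torus`, `torus_sum_exp_le`).

WHY (located).  § [NE7bP1-G122-HANDOFF] NEXT (3)(c): the `ℤ^d` propagator of the road's class is to be the limit of the torus propagators
along the tower of periods `3^k`; two consecutive levels, read on the larger torus, solve equations whose potentials AND sources agree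
on the central window and differ only outside it — so their difference solves `Hw = g` with `g` supported FAR from the centre.  This
file is that one estimate, on one torus: decompose `g` into its block pieces `𝟙_{B_yb}g` (`|·| ≤ M`, and `≤ 0` for the near blocks), solve
each (`(148)`), bound each solution by (155) §1 (`|w_yb x| ≤ C₁Me^{−δ₁ρ_s(bt x, yb)}`, and `0` for the near blocks), sum by linearity and
uniqueness ((133)), and split the rate: for a far block `ρ_s(bt x, yb) ≥ R − ρ_s(bt x, y_c)`, so `e^{−δ₁ρ} ≤ e^{−δρ_s(bt x, yb)}·e^{δρ_s(bt x, y_c)}e^{−δR}`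
with `δ = δ₁∕2`, and `Σ_yb e^{−δρ_s(bt x, yb)} ≤ K_δ` ((132)).

WHAT IS PROVED ([folklore]; fine torus `Site d ((n+1)s)`, coarse `Site d s`, `[NeZero s]`; the action DISPLAYED; `bt x = σ_s(blk n (wm x))`,
`ρ_s` the `ℓ¹` circular distance; `K_δ = (2∕(1 − e^{−δ}))^d`):
* §1 `blockPiece_le` (`|𝟙[bt x = yb]·g x| ≤ (R ≤ ρ_s(yb, y_c) ? M : 0)` when `g` vanishes on the near blocks and `|g| ≤ M`).
* §2 THE HEADLINE **`far_source_decay`**: `d ≥ 3`, `a > 0`, `λ < min(2,a)`, `Λ ≥ 0` ⟹ `∃ C δ > 0`: for ALL `n, s`, ALL `−λ ≤ V ≤ Λ`, every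
  centre `y_c`, radius `R`, every `g` with `|g| ≤ M` and `g x = 0` whenever `ρ_s(bt x, y_c) < R`, every `Hw = g`, every `x`:
  `|w x| ≤ C·M·e^{δρ_s(bt x, y_c)}·e^{−δR}`.
* §3 toy (`d = 3`).

HONEST (what this is NOT).  A torus estimate (the limit is the sequel); `d ≥ 3` only (through (155)); constants existential and far from
sharp; cubic periods; scalar skeleton ((A3), NC-NE7b-α UNRULED); nothing of the covariant propagators of [B4]–[B6]; nothing of Bałaban's.
BY-NAME EFFECT ON THE WALL: NONE.  NE7b NOT PRINTED ∕ NOT PROVED; spine PROVED 0∕9; rung (B)+1 on a FINITE torus — NOT infinite volume,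
NOT the mass gap, NOT Clay.  HONEST DEPENDENCY: continuum YM on T⁴ ⇐ BetaPertH ∧ nine spine estimates (0∕9 proved); BetaPertH ⇐ (D1) ∧
(D4) ∧ CAP+tail; G-an2-4 gates asym, D1 and NE2∕3∕4.
-/

set_option autoImplicit false

noncomputable section

namespace Summit.QuantumFields.BalabanUV.T4Continuum.NE7b.SupTorusFarSourceDecay

open Real
open Literature.MathematicalPhysics.QuantumFieldTheory.Balaban1983to89
open B6QGQLower276 (X e blk B side chart mem_B sum_B sum_B_const card_cube blk_chart)
open Beta (Site siteOf windowMap siteOf_windowMap siteOf_add siteOf_sub)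
open SupTorusBlockDistance (isPseudoDist_torus torus_sum_exp_le)
open SupTorusActionForm (action_injective action_sum_smul)
open SupTorusSupNormBound (action_surjective)
open SupTorusPointwiseRoadColumn (propagator_pointwise_decay_road)

variable {d : ℕ}

/-! ## §1. The block pieces of a source vanishing near the centre -/

/-- **THE BLOCK PIECES OF A FAR SOURCE**: if `|g| ≤ M` and `g x = 0` whenever `ρ_s(bt x, y_c) < R`, then the piece of `g` on the block `yb`
satisfies `|𝟙[bt x = yb]·g x| ≤ M` if `R ≤ ρ_s(yb, y_c)` and `≤ 0` otherwise. [folklore] -/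
theorem blockPiece_le (n s : ℕ) [NeZero s] (y_c : Site d s) {R M : ℝ} (g : Site d ((n + 1) * s) → ℝ) (hgM : ∀ x, |g x| ≤ M)
    (hg0 : ∀ x, ∑ i, ((((siteOf d s (blk n (windowMap d ((n + 1) * s) x))) i - y_c i).valMinAbs.natAbs : ℕ) : ℝ) < R → g x = 0)
    (yb : Site d s) (x : Site d ((n + 1) * s)) :
    |(if siteOf d s (blk n (windowMap d ((n + 1) * s) x)) = yb then (1 : ℝ) else 0) * g x|
      ≤ if R ≤ ∑ i, (((yb i - y_c i).valMinAbs.natAbs : ℕ) : ℝ) then M else 0 := by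
  have hM : 0 ≤ M := (abs_nonneg _).trans (hgM x)
  by_cases hx : siteOf d s (blk n (windowMap d ((n + 1) * s) x)) = yb
  · rw [if_pos hx, one_mul]
    by_cases hR : R ≤ ∑ i, (((yb i - y_c i).valMinAbs.natAbs : ℕ) : ℝ)
    · rw [if_pos hR]; exact hgM x
    · rw [if_neg hR, hg0 x (by rw [hx]; exact not_le.1 hR), abs_zero]
  · rw [if_neg hx, zero_mul, abs_zero]; split_ifs <;> linarith

/-! ## §2. THE END: a far source is exponentially invisible near the centre -/

/-- **HEADLINE — A SOURCE SUPPORTED AT `ρ_s`-DISTANCE `≥ R` FROM `y_c` PRODUCES `|H_V⁻¹g|(x) ≤ C·‖g‖_∞·e^{δρ_s(bt x, y_c)}·e^{−δR}` ON THE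
ROAD'S CLASS `−λ ≤ V ≤ Λ`, `d ≥ 3`, every mesh, every volume** — `(C, δ)` from `(d, a, λ, Λ)` and `C(d)` only: block decomposition of `g`,
(148) for each piece, (155) §1 for each solution (the near pieces are `0`), linearity ((133) `action_sum_smul`) and uniqueness ((133)
`action_injective`), the rate split `ρ_s(bt x, yb) ≥ R − ρ_s(bt x, y_c)` and the coarse exponential sum ((132) `torus_sum_exp_le`). [folklore] -/
theorem far_source_decay (hd : 3 ≤ d) (a : ℝ) (ha : 0 < a) {lam Lam : ℝ} (hlam : lam < min 2 a) (hLam : 0 ≤ Lam) :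
    ∃ C δ : ℝ, 0 < C ∧ 0 < δ ∧ ∀ (n s : ℕ) [NeZero s] (V : Site d ((n + 1) * s) → ℝ), (∀ x, -lam ≤ V x) → (∀ x, V x ≤ Lam) →
      ∀ (y_c : Site d s) (R M : ℝ) (w g : Site d ((n + 1) * s) → ℝ), (∀ x, |g x| ≤ M) →
      (∀ x, ∑ i, ((((siteOf d s (blk n (windowMap d ((n + 1) * s) x))) i - y_c i).valMinAbs.natAbs : ℕ) : ℝ) < R → g x = 0) →
      (∀ x, ((n : ℝ) + 1) ^ 2 * ∑ μ, (2 * w x - w (x + siteOf d ((n + 1) * s) (e μ)) - w (x - siteOf d ((n + 1) * s) (e μ)))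
        + a / ((n : ℝ) + 1) ^ d * ∑ q ∈ B n (blk n (windowMap d ((n + 1) * s) x)), w (siteOf d ((n + 1) * s) q) + V x * w x = g x) →
      ∀ x : Site d ((n + 1) * s),
        |w x| ≤ C * M * exp (δ * ∑ i, ((((siteOf d s (blk n (windowMap d ((n + 1) * s) x))) i - y_c i).valMinAbs.natAbs : ℕ) : ℝ))
          * exp (-(δ * R)) := by
  classical
  have hm0 : 0 < min 2 a - lam := by linarith
  obtain ⟨C₁, δ₁, hC₁, hδ₁, H155⟩ := propagator_pointwise_decay_road (d := d) hd a ha hlam hLam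
  set δ : ℝ := δ₁ / 2 with hδ
  have hδ0 : 0 < δ := by positivity
  set Kδ : ℝ := (2 * (1 - exp (-δ))⁻¹) ^ d with hKδ
  have hKδ0 : 0 < Kδ := pow_pos (mul_pos two_pos (inv_pos.2 (sub_pos.2 (exp_lt_one_iff.2 (by linarith))))) d
  refine ⟨C₁ * Kδ, δ, by positivity, hδ0, ?_⟩
  intro n s _ V hV hV' y_c R M w g hgM hg0 hw x
  have hP := isPseudoDist_torus (d := d) s
  have hM : 0 ≤ M := (abs_nonneg _).trans (hgM x)
  -- the block pieces and their propagators
  set piece : Site d s → Site d ((n + 1) * s) → ℝ := fun yb x' =>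
    (if siteOf d s (blk n (windowMap d ((n + 1) * s) x')) = yb then (1 : ℝ) else 0) * g x' with hpiece
  have hsupp : ∀ yb x', siteOf d s (blk n (windowMap d ((n + 1) * s) x')) ≠ yb → piece yb x' = 0 := fun yb x' hx' => by
    simp only [hpiece, if_neg hx', zero_mul]
  have hple : ∀ yb x', |piece yb x'| ≤ if R ≤ ∑ i, (((yb i - y_c i).valMinAbs.natAbs : ℕ) : ℝ) then M else 0 :=
    fun yb x' => blockPiece_le n s y_c g hgM hg0 yb x'
  choose wy hwy using fun yb : Site d s => action_surjective n a s ha.le hm0 V hV (piece yb)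
  -- each propagator decays from its block; the near ones vanish
  have hdec : ∀ yb x', exp (δ₁ * ∑ i, ((((siteOf d s (blk n (windowMap d ((n + 1) * s) x'))) i - yb i).valMinAbs.natAbs : ℕ) : ℝ))
      * |wy yb x'| ≤ C₁ * (if R ≤ ∑ i, (((yb i - y_c i).valMinAbs.natAbs : ℕ) : ℝ) then M else 0) :=
    fun yb x' => H155 n s V hV hV' yb _ (wy yb) (piece yb) (hsupp yb) (hple yb) (hwy yb) x'
  -- linearity and uniqueness: `w = Σ_yb w_yb`
  have hsum_eq : ∀ x', ((n : ℝ) + 1) ^ 2 * ∑ μ, (2 * (∑ yb ∈ Finset.univ, (1 : ℝ) * wy yb x')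
        - (∑ yb ∈ Finset.univ, (1 : ℝ) * wy yb (x' + siteOf d ((n + 1) * s) (e μ)))
        - (∑ yb ∈ Finset.univ, (1 : ℝ) * wy yb (x' - siteOf d ((n + 1) * s) (e μ))))
      + a / ((n : ℝ) + 1) ^ d * ∑ q ∈ B n (blk n (windowMap d ((n + 1) * s) x')), (∑ yb ∈ Finset.univ, (1 : ℝ) * wy yb (siteOf d ((n + 1) * s) q))
      + V x' * (∑ yb ∈ Finset.univ, (1 : ℝ) * wy yb x') = g x' := by
    intro x'
    rw [action_sum_smul n a s Finset.univ (fun _ => (1 : ℝ)) wy V x']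
    simp only [hwy, one_mul, hpiece]
    rw [← Finset.sum_mul, Finset.sum_ite_eq, if_pos (Finset.mem_univ _), one_mul]
  have hweq : w = fun x' => ∑ yb ∈ Finset.univ, (1 : ℝ) * wy yb x' :=
    action_injective n a s ha.le hm0 V hV w (fun x' => ∑ yb ∈ Finset.univ, (1 : ℝ) * wy yb x') fun x' => by rw [hw x', hsum_eq x']
  -- termwise bound with the split rate
  set ρc : ℝ := ∑ i, ((((siteOf d s (blk n (windowMap d ((n + 1) * s) x))) i - y_c i).valMinAbs.natAbs : ℕ) : ℝ) with hρc
  have hterm : ∀ yb : Site d s, |wy yb x| ≤ C₁ * M * exp (δ * ρc) * exp (-(δ * R))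
      * exp (-(δ * ∑ i, ((((siteOf d s (blk n (windowMap d ((n + 1) * s) x))) i - yb i).valMinAbs.natAbs : ℕ) : ℝ))) := by
    intro yb
    set ρ : ℝ := ∑ i, ((((siteOf d s (blk n (windowMap d ((n + 1) * s) x))) i - yb i).valMinAbs.natAbs : ℕ) : ℝ) with hρ
    have hρ0 : 0 ≤ ρ := Finset.sum_nonneg fun _ _ => Nat.cast_nonneg _
    have h := hdec yb x
    have hE := exp_pos (δ₁ * ρ)
    have habs : |wy yb x| ≤ C₁ * (if R ≤ ∑ i, (((yb i - y_c i).valMinAbs.natAbs : ℕ) : ℝ) then M else 0) * exp (-(δ₁ * ρ)) := by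
      rw [exp_neg, ← div_eq_mul_inv, le_div_iff₀ hE, mul_comm]; exact h
    by_cases hR : R ≤ ∑ i, (((yb i - y_c i).valMinAbs.natAbs : ℕ) : ℝ)
    · rw [if_pos hR] at habs
      -- `ρ ≥ R − ρc`, so `e^{−δ₁ρ} = e^{−δρ}e^{−δρ} ≤ e^{−δρ}·e^{δρc}e^{−δR}`
      have htri : ∑ i, (((yb i - y_c i).valMinAbs.natAbs : ℕ) : ℝ)
          ≤ ∑ i, (((yb i - (siteOf d s (blk n (windowMap d ((n + 1) * s) x))) i).valMinAbs.natAbs : ℕ) : ℝ) + ρc := hP.triangle yb _ y_c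
      rw [hP.symm yb (siteOf d s (blk n (windowMap d ((n + 1) * s) x)))] at htri
      have hρR : R - ρc ≤ ρ := by linarith
      have hsplit : exp (-(δ₁ * ρ)) ≤ exp (δ * ρc) * exp (-(δ * R)) * exp (-(δ * ρ)) := by
        rw [← exp_add, ← exp_add]
        refine exp_le_exp.2 ?_
        have e1 : δ₁ * ρ = δ * ρ + δ * ρ := by rw [hδ]; ring
        rw [e1]
        have := mul_le_mul_of_nonneg_left hρR hδ0.le
        linarith
      calc |wy yb x| ≤ C₁ * M * exp (-(δ₁ * ρ)) := habs
        _ ≤ C₁ * M * (exp (δ * ρc) * exp (-(δ * R)) * exp (-(δ * ρ))) := mul_le_mul_of_nonneg_left hsplit (by positivity)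
        _ = _ := by ring
    · rw [if_neg hR, mul_zero, zero_mul] at habs
      exact habs.trans (by positivity)
  have hKsum : ∑ yb : Site d s, exp (-(δ * ∑ i, ((((siteOf d s (blk n (windowMap d ((n + 1) * s) x))) i - yb i).valMinAbs.natAbs : ℕ) : ℝ)))
      ≤ Kδ := torus_sum_exp_le (d := d) s hδ0 _
  calc |w x| = |∑ yb ∈ Finset.univ, (1 : ℝ) * wy yb x| := by rw [hweq]
    _ ≤ ∑ yb ∈ Finset.univ, |(1 : ℝ) * wy yb x| := Finset.abs_sum_le_sum_abs _ _
    _ ≤ ∑ yb ∈ Finset.univ, C₁ * M * exp (δ * ρc) * exp (-(δ * R))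
        * exp (-(δ * ∑ i, ((((siteOf d s (blk n (windowMap d ((n + 1) * s) x))) i - yb i).valMinAbs.natAbs : ℕ) : ℝ))) :=
        Finset.sum_le_sum fun yb _ => by rw [one_mul]; exact hterm yb
    _ = C₁ * M * exp (δ * ρc) * exp (-(δ * R))
        * ∑ yb : Site d s, exp (-(δ * ∑ i, ((((siteOf d s (blk n (windowMap d ((n + 1) * s) x))) i - yb i).valMinAbs.natAbs : ℕ) : ℝ))) :=
        (Finset.mul_sum _ _ _).symm
    _ ≤ C₁ * M * exp (δ * ρc) * exp (-(δ * R)) * Kδ := mul_le_mul_of_nonneg_left hKsum (by positivity)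
    _ = C₁ * Kδ * M * exp (δ * ρc) * exp (-(δ * R)) := by ring

/-! ## §3. Toy -/

/-- Toy (`d = 3`, `a = 1`, `λ = 0`, `Λ = 1`): the constants exist. -/
example : ∃ C δ : ℝ, 0 < C ∧ 0 < δ :=
  let ⟨C, δ, hC, hδ, _⟩ := far_source_decay (d := 3) le_rfl 1 one_pos (lam := 0) (Lam := 1)
    (by rw [min_eq_right (by norm_num : (1 : ℝ) ≤ 2)]; norm_num) zero_le_one
  ⟨C, δ, hC, hδ⟩

end Summit.QuantumFields.BalabanUV.T4Continuum.NE7b.SupTorusFarSourceDecay
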